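import Literature.NumberTheory.EllipticCurves.Rank1Residual.PrintShapeTorsion
import Literature.NumberTheory.EllipticCurves.Rank1Residual.Predicates
import HarnessLib

/-!
# Castella–Grossi–Lee–Skinner 2022, Theorem F: the `p`-part of the BSD formula in analytic rank `1` at a NON-ANOMALOUS Eisenstein prime `p > 2` of good ordinary reduction whose isogeny character is (ramified ∧ odd) or (unramified ∧ even)

HONEST FRAMING (cell `b2b-bsdres`, run/shared/lean/b2b/bsd-rank1-residual/; page 1 everywhere):
the goal is to DELETE the COMBINATION-SHAPED residual classes of the BSD formula for ALL analytic-rank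
`≤ 1` curves over `ℚ` from PUBLISHED theorems only, so that the remainder becomes exactly the
CONSTRUCTION-SHAPED classes, which are TYPED, not attempted; this is not "finishing BSD". This file
vendors ONE published theorem as a named fact (`def … : Prop`, nothing asserted; D-0014/D-0026), with
its hypotheses spelled in the cell's predicate vocabulary (`Rank1Residual/Predicates.lean` =
bsdN/HYPOTHESES.md), and proves its bookkeeping consequence `BSD(E,p)` (Miller) through the cell's
bridge `Rank1Residual/PrintShapeTorsion.lean` — exactly as the sibling file
`CastellaGrossiSkinner2025/EisensteinPPartBSD.lean` (Math. Ann. 393 (2025) Thm. D, harvest seat,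
p190652) does for the later theorem that SUPERSEDES this one at statement level.

WHY VENDOR A SUPERSEDED THEOREM (prover x1a gen 7, second-level audit of the good-Eisenstein chain,
HOME/b2b-bsdres-x1a/X1-CHAIN.md §15): Castella–Grossi–Skinner 2025 Thm. D removes the parity
hypothesis of Theorem F, but its proof goes through Mazur's cyclotomic main conjecture (their Thm. A/C),
whose Beilinson–Flach input — CGS 2025 Thm. 3.1.1 of arXiv v1 = PRINTED Thm. 4.1.1 (Math. Ann. 393
(2025); v1 numbers the Introduction §0, print §1) (two-variable Beilinson–Flach classes, Coleman maps
and explicit reciprocity laws for `f ⊗` the CM Hida family of `K`) — is, in print, "proved in [BST],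
where it is deduced from results in [KLZ17] in combination with results in [Betina–Dimitrov–Pozzi]"
`[corpus: paper:arxiv-2303.04373 p0016 L53–L56]`, with [BST] = Burungale–Skinner–Tian, *Elliptic
curves and Beilinson–Kato elements: rank one aspects*, "preprint, 2021" `[ibid. p0029 L46–L49]`
(no journal record as of 2026-08-19: cell FRESHNESS.md W2; X10-AUDIT.md §8 row Y6 recorded the same
sentence for the Yan–Zhu 2026 audit). In the ACCEPTED / PRINTED text (arXiv:2303.04373v2 = Math. Ann.
393 (2025), TeX l. 1701–1702) the same proof sentence reads "This is proved in [BSTW23, §5], where it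
is deduced from results in [KLZ17] …" with `\bibitem[BSTW23]{BST}` = A. Burungale, C. Skinner,
Y. Tian, X. Wan, *Zeta elements for elliptic curves and applications*, preprint (= arXiv:2409.01350,
§5 "Zeta elements over imaginary quadratic fields: the ordinary case"; unrefereed as of 2026-08-26)
— referee C R278 words the component of record on the printed citation
(`CGS25-ThmA-Thm4.1.1@BSTW24-§5(arXiv:2409.01350,preprint;read)`); the dependence on a PREPRINT is
unchanged in kind (version audit: `pub/bsd-uniform/ue/EISENSTEIN-AS-PRINTED.md` §3.2).
Theorem F's printed proof, by contrast, uses NO Beilinson–Flach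
class: anticyclotomic main conjecture of CGLS Thm. C (Heegner-point Kolyvagin system à la Howard 2004 +
Bertolini–Darmon–Prasanna / Castella–Hsieh + Rubin 1991 / Hida 2010 on the algebraic and analytic
sides), the anticyclotomic control theorem of Jetchev–Skinner–Wan 2017, the BDP formula, Gross–Zagier,
Kolyvagin, and — for the rank-`0` quadratic-twist partner `E^K` — Greenberg–Vatsal 2000 Thm. 1.3 +
Greenberg LNM 1716 Thm. 4.1 (CGLS Thm. 5.1.4); its bibliography's preprints are [BCK] (now Burungale–
Castella–Kim, Algebra Number Theory 15 (2021), cited for the equivalence of the two anticyclotomic main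
conjectures, Prop. 4.2.1 "whose proof still applies after inverting `p`") and [Skinner–Zhang 2014]
(cited only for the Tamagawa identity `Σ_{w∣ℓ} ord_p c_w(E/K) = ord_p c_ℓ(E) + ord_p c_ℓ(E^K)`,
elementary under (Heeg): a prime `ℓ ∣ N` splits in `K`, so `E^K ≅ E` over `ℚ_ℓ`). Vendoring
Theorem F lets the cell's complement theorem "good Eisenstein `p > 2`, `r_an ≤ 1`, outside X1 ⇒
`BSD(E,p)`" (`Rank1Residual/EisensteinGoodComplement.lean`) be SPLIT in the kernel into the part that
rests on Beilinson–Flach-free print (Greenberg–Vatsal at `r_an = 0 ∧ gvpar`, Theorem F at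
`¬anom ∧ r_an = 1 ∧ ¬gvpar`) and the part that rests on CGS 2025 Thm. D alone
(`¬anom ∧ ((r_an = 0 ∧ ¬gvpar) ∨ (r_an = 1 ∧ gvpar))`) — file
`Rank1Residual/EisensteinGoodComplementSplit.lean`. No label is changed by this file; the referee
rules on the proposed flag `CGS25-BST-Thm311` (same family as `YZ26-BF-equiv` / `BCS25-BF-equiv`).

## Citation header (read by this seat on the store's LaTeXML text of the arXiv version, `paper:arxiv-2008.02571`)

* Authors: Francesc Castella, Giada Grossi, Jaehoon Lee, Christopher Skinner.
* Title: *On the anticyclotomic Iwasawa theory of rational elliptic curves at Eisenstein primes*.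
* Venue: Invent. Math. **227** (2022), no. 2, 517–580 (published online 2021-10),
  doi:10.1007/s00222-021-01072-y (Crossref record; bib key `CastellaGrossiLeeSkinner2022`; the older
  tree key `CastellaEtAl2021` names the same paper) = arXiv:2008.02571. REFEREED / PUBLISHED.
* Theorem: **Theorem F** of the Introduction (the sixth lettered intro theorem; LaTeXML renders the
  lettered theorems as "Theorem 1 … Theorem 6", so Theorem F = "Theorem 6" at
  `[corpus: paper:arxiv-2008.02571 p0004 L19–L33]`) = **Theorem 5.3.1** of the body ("Theorem 55",
  §5.3 "Proof of the `p`-part of BSD formula", `[ibid. p0025 L46–L60]`: "The following is Theorem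
  (thm:F) in the introduction"). The journal pagination of Thm. 5.3.1 is not independently held
  (cite-only want, like acq-08184 for the CGS sibling).
* Verbatim (body statement, Thm. 5.3.1; the intro version says "Under the hypotheses of Theorem E
  [`E/ℚ` an elliptic curve, `p > 2` an Eisenstein prime for `E`, so that `E[p]^{ss} = 𝔽_p(φ) ⊕ 𝔽_p(ψ)`
  as `G_ℚ`-modules, and assume that `φ|_{G_p} ≠ 1, ω`], assume in addition that `φ` is either
  ramified at `p` and odd, or unramified at `p` and even"):

> **Theorem 5.3.1 (= Theorem F).** Let `E/ℚ` be an elliptic curve, and let `p > 2` be a prime of good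
> ordinary reduction for `E`. Assume that `E` admits a cyclic `p`-isogeny with kernel `C = 𝔽_p(φ)`,
> with `φ : G_ℚ → 𝔽_p^×` such that
> * `φ|_{G_p} ≠ 1, ω`,
> * `φ` is either ramified at `p` and odd, or unramified at `p` and even.
>
> If `ord_{s=1} L(E,s) = 1`, then
> `ord_p( L'(E,1) / (Reg(E/ℚ) · Ω_E) ) = ord_p( #Ш(E/ℚ) ∏_{ℓ∤∞} c_ℓ(E/ℚ) )`.
> In other words, the `p`-part of the Birch–Swinnerton-Dyer formula for `E` holds.

  with (intro, after Thm. F) "`Reg(E/ℚ)` is the regulator of `E(ℚ)`, `Ω_E = ∫_{E(ℝ)} |ω_E|` is the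
  Néron period associated to the Néron differential `ω_E`, and `c_ℓ(E/ℚ)` is the Tamagawa number of
  `E` at the prime `ℓ`"; `ω` = the Teichmüller character; `G_p` = a decomposition group at `p`
  (§1: "for the prime `v ∣ p` we assume `G_v` is chosen so that it is identified with
  `Gal(ℚ̄_p/ℚ_p)` via `ι_p`"). Printed proof (§5.3, `[ibid. p0025 L61–L115]`): choose `K` imaginary
  quadratic with `D_K < −4` odd, every `ℓ ∣ N` split, `p` split, `L(E^K,1) ≠ 0`; Gross–Zagier +
  Kolyvagin give `rank E(K) = 1`, `#Ш(E/K) < ∞`; Thm. C (anticyclotomic main conjecture, `𝓕_E(0) =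
  u · 𝓛_E(0)`), the anticyclotomic control theorem (Thm. 5.1.1 = [JSW17], needs `E(K)[p] = 0`, implied
  by the hypotheses on `φ`) and the BDP formula give `ord_p #Ш(E/K)` in terms of the Heegner index;
  Gross–Zagier rewritten, `Ш(E/K)[p^∞] ≅ Ш(E/ℚ)[p^∞] ⊕ Ш(E^K/ℚ)[p^∞]` (`p` odd) and the Tamagawa
  identity give `defect_p(E) = defect_p(E^K)`; "Finally, by our hypotheses on `φ` the curve `E^K`
  satisfies the hypotheses of Theorem (thmGV) [Greenberg–Vatsal 2000 + Greenberg, = Thm. 5.1.4], and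
  hence the right-hand side vanishes".

## Hypotheses, enumerated (word for word → cell predicate)

1. `E/ℚ` an elliptic curve — `W : WeierstrassCurve ℚ`, `[W.IsElliptic]`, globally minimal model
   (`[W.IsGloballyMinimal]`, needed for `a_p`).
2. "`p > 2`" — `2 < p`. No `p ≥ 5` in the STATEMENT; `p = 3` allowed as printed (the paper applies its
   theorems at `p = 3`, e.g. Cor. 5.2.2 with [BKLS]). SECOND-LEVEL NOTE (not a hypothesis of the fact;
   documentation note `CGLS22-§3-6N@3`, now RETIRED — see the end of this item): in the v1 CORPUS
   TEXT the Kolyvagin-system sections behind Thm. C carry the standing sentence "let `p ∤ 6N` be a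
   prime of good ordinary reduction" (§3.2, `[ibid. p0014 L81]`; §3.4 and §4.1 "Let `E`, `p`, `K` be
   as in §3.2"), whereas §1 and Thms. C/E/F say `p > 2`; no use of `p > 3` is visible in §3.3 (grep
   `p>3|geq 5`: none; Howard 2004's own standing hypothesis is "`p` odd, `p`, `D`, `N` pairwise
   coprime"), and Castella–Grossi–Skinner 2025 §5 restates the same Kolyvagin setting under
   "`p ∤ 2N`" (`[corpus: paper:arxiv-2303.04373 p0020 L10]`). RETIREMENT (ARM P, 2026-08-26/27): on
   the VERSION OF RECORD (Invent. Math. 227 (2022) = arXiv v2; TeX `cgls22-v2final/Eisenstein.tex`,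
   sha256-16 `bfde6382e71ad74c`) the sentence reads "`p ∤ 2N`" — §2 opening (TeX l. 935: "Let `E/ℚ`
   be an elliptic curve of conductor `N`, `p ∤ 2N` a prime of good reduction for `E`") and §3.2
   "Bounding Selmer groups" opening (TeX l. 1253: "let `p ∤ 2N` be a prime of good ordinary reduction
   for `E`"); "`6N`" occurs in v1 only. Referee C2, ROUND 358 (δ): "`CGLS22-§3-6N@3` — RETIREMENT
   CONFIRMED on the version of record"; referee A, R172.2: "`p = 3` is admitted under T-CGLS-F as
   printed, flag-free". The note is kept here only as a reading record; it never was a hypothesis.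
3. "a prime of good ordinary reduction for `E`" — `GoodOrd W p` (`good(p) ∧ p ∤ a_p`). (For `p > 2`
   good with `E[p]` reducible, ordinarity is automatic — tree theorem
   `Rank1Residual.goodOrd_of_red_of_good`, Serre 1972 Prop. 12 — but it is printed, so it is kept.)
4. "`E` admits a cyclic `p`-isogeny with kernel `C = 𝔽_p(φ)`" — a rational line
   `Φ ≤ E[p](ℚ̄)` (`IsRationalLine W p Φ`: `Γ_ℚ`-stable of order `p`); `φ` = the character of `Γ_ℚ` on
   `Φ`.
5. "`φ|_{G_p} ≠ 1, ω`" — rendered `¬ Anom W p` (`a_p ≢ 1 (mod p)` given good ∧ reducible), EXACTLY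
   as in the CGS 2025 sibling (its docstring item 5), and here no longer a dictionary taken on trust:
   the tree theorems `Rank1Residual.not_anom_iff_cgs_of_good` /
   `not_anom_iff_cgs_of_mem_primesAbove` (x1a gen 6, p192666/p192887) prove, for `p > 2` good and ANY
   rational line `Φ` and ANY prime `𝔓'` above `p`, `¬ Anom W p ⟺ (D_{𝔓'} does not fix Φ pointwise) ∧
   (D_{𝔓'} does not act trivially on E[p]/Φ)`, i.e. `φ|_{G_p} ≠ 1 ∧ φ|_{G_p} ≠ ω` for the character
   `φ` of THAT line (`ψ = ωφ⁻¹` is the character of `E[p]/Φ`). The consumer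
   `Rank1Residual.bsdp_of_thmF_of_cgls` (split file) takes the decomposition-group form literally.
6. "`φ` is either ramified at `p` and odd, or unramified at `p` and even" — for the SAME line `Φ`:
   `(¬ LineUnramifiedAt W p Φ ∧ LineOdd W p Φ) ∨ (LineUnramifiedAt W p Φ ∧ LineEven W p Φ)`
   (`LineUnramifiedAt`: every inertia group at every prime above `p` acts trivially on `Φ`;
   `LineEven`/`LineOdd`: complex conjugation acts by `+1`/`−1` on `Φ`; Predicates.lean design note (3),
   the same atoms as `GVPar`). This is the OPPOSITE parity class to Greenberg–Vatsal's
   "(ramified ∧ even) ∨ (unramified ∧ odd)" (`GVPar`): at a good ordinary odd `p` it says "the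
   unramified constituent of `E[p]^{ss}` is EVEN", a property of the isogeny class (tree:
   `gvType_iff_of_isRationalLine`, `coType_of_not_gvPar`: on a curve with `¬ GVPar W p` EVERY rational
   line is of this co-type) — the cell's parity type A. As printed, the quadratic twist `E^K` by the
   imaginary `K` then satisfies (GV) (odd twist flips the parity of both constituents).
7. "`ord_{s=1} L(E,s) = 1`" — `W.analyticRank = 1`; `L'(E,1) = W.leadingLCoeff` (`1! = 1`).
8. `#Ш(E/ℚ)` — `W.shaOrder` under the binder `Finite W.sha` (Gross–Zagier–Kolyvagin, bsd.S17
   `rank_eq_analyticRank_of_analyticRank_le_one`; carried as a binder exactly as in the CGS / BCS / JSW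
   sibling facts).
9. Torsion: the printed display has NO torsion term — consistent, since a rational point of order `p`
   at a good `p > 2` forces `a_p ≡ 1 (mod p)` (tree theorem `Rank1Residual.anom_of_dvd_torsionOrder`,
   x1a gen 6), excluded by item 5. The consumer below carries `p ∤ #E(ℚ)_tors` as an explicit binder
   (to keep this file's imports at the sibling's level); the split file discharges it by
   `Rank1Residual.not_dvd_torsionOrder_of_not_anom`. Conclusion shape = CITED-FACTS shape (c)
   "quotient, no torsion", literally the sibling's display:
   `∃ q : ℚ, L'(E,1)/(Ω_E·Reg) = q ∧ ord_p q = ord_p #Ш + ord_p ∏ c_ℓ`.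

No image condition ((irr)/(surj)/(im)) — the theorem is ABOUT reducible `E[p]`; no (ram) prime, no
conductor/semistability/CM/Tamagawa condition. No `_holds` is to be expected (anticyclotomic Iwasawa
theory, Kolyvagin systems, BDP `p`-adic `L`-functions, Rubin's main conjecture: none in Mathlib);
consumers take `(h : thmF_padicValRat_bsd_rank_one)`. This file introduces exactly ONE named fact and
proves its two bookkeeping consumers; nothing else is minted.

## References
* [CastellaGrossiLeeSkinner2022] F. Castella, G. Grossi, J. Lee, C. Skinner, *On the anticyclotomic
  Iwasawa theory of rational elliptic curves at Eisenstein primes*, Invent. Math. 227 (2022) 517–580 =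
  arXiv:2008.02571, Theorem F = Thm. 5.3.1; Thm. C; Thm. 5.1.1 (control, [JSW17]); Thm. 5.1.4 (GV).
* [CastellaGrossiSkinner2025] F. Castella, G. Grossi, C. Skinner, Math. Ann. 393 (2025) 2451–2506 =
  arXiv:2303.04373v2, Thm. D (tree `CastellaGrossiSkinner2025.thmD_padicValRat_bsd_rank_le_one`) and
  Thm. 4.1.1 (arXiv v1: Thm. 3.1.1) with its proof sentence (the preprint input: printed
  "[BSTW23, §5]" = Burungale–Skinner–Tian–Wan arXiv:2409.01350 §5; v1 key "[BST]", preprint 2021).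
* R. Greenberg, V. Vatsal, Invent. Math. 142 (2000) Thm. 1.3 (tree `GreenbergVatsal2000`).
* bsdN/HYPOTHESES.md rows T-CGS, T-GV0; RESIDUAL-CASES.md §a.0 `anom(p)`, `gvpar(p)`, §a.1 C6/C7,
  §a.2 X1; HOME/CITED-FACTS.md row C28 (this theorem, previously "not vendored: superseded by A47").
* R. L. Miller, LMS J. Comput. Math. 14 (2011) Def. 1.1 (`Miller2011LMS`) — `BSDp`.
-/

noncomputable section

open scoped Classical

open WeierstrassCurve Literature.NumberTheory.EllipticCurves
  Literature.NumberTheory.EllipticCurves.Rank1Residual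

namespace Literature.NumberTheory.EllipticCurves.CastellaGrossiLeeSkinner2022

/-- **Castella–Grossi–Lee–Skinner, Invent. Math. 227 (2022) 517–580 = arXiv:2008.02571, Theorem F
(Introduction; LaTeXML "Theorem 6") = Theorem 5.3.1 (§5.3; LaTeXML "Theorem 55")**: "Let `E/ℚ` be an
elliptic curve, and let `p > 2` be a prime of good ordinary reduction for `E`. Assume that `E` admits
a cyclic `p`-isogeny with kernel `C = 𝔽_p(φ)`, with `φ : G_ℚ → 𝔽_p^×` such that (•) `φ|_{G_p} ≠ 1, ω`,
(•) `φ` is either ramified at `p` and odd, or unramified at `p` and even. If `ord_{s=1} L(E,s) = 1`,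
then `ord_p(L'(E,1)/(Reg(E/ℚ)·Ω_E)) = ord_p(#Ш(E/ℚ) ∏_{ℓ∤∞} c_ℓ(E/ℚ))`. In other words, the
`p`-part of the Birch–Swinnerton-Dyer formula for `E` holds." Hypotheses in the cell's predicate
names (module docstring, items 1–9): `2 < p`, `GoodOrd W p`, a rational line `Φ ≤ E[p]`
(`IsRationalLine W p Φ`) which is (ramified at `p` ∧ odd) ∨ (unramified at `p` ∧ even),
`¬ Anom W p` (= "`φ|_{G_p} ≠ 1, ω`" for that line, tree theorem `not_anom_iff_cgs_of_good`),
`W.analyticRank = 1`, `Finite W.sha` (binder, bsd.S17). No image, (ram), conductor, CM or Tamagawa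
hypothesis. Conclusion: `L'(E,1)/(Ω_E·Reg)` is a rational `q` with `ord_p q = ord_p #Ш + ord_p ∏ c_ℓ`
(no torsion term, as printed). PUBLISHED; Beilinson–Flach-free (proof: CGLS Thm. C + JSW control +
BDP + Gross–Zagier + Kolyvagin + Greenberg–Vatsal for the twist `E^K`). Superseded at statement
level by Castella–Grossi–Skinner 2025 Thm. D (no parity hypothesis), whose proof however imports the
Beilinson–Flach reciprocity laws of CGS Thm. 4.1.1 (arXiv v1: Thm. 3.1.1), "proved in [BSTW23, §5]"
(Burungale–Skinner–Tian–Wan arXiv:2409.01350 §5, preprint; v1: "[BST]", preprint 2021).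
[cite: CastellaGrossiLeeSkinner2022, Theorem F = Thm. 5.3.1 (arXiv:2008.02571 §5.3; Introduction Thm. F)] -/
def thmF_padicValRat_bsd_rank_one : Prop :=
  ∀ (W : WeierstrassCurve ℚ) [W.IsElliptic] [W.IsGloballyMinimal] (p : ℕ) [Fact p.Prime],
    2 < p → GoodOrd W p →
    (∃ Φ : AddSubgroup (geomTorsion W (p : ℤ)), IsRationalLine W p Φ ∧
      ((¬ LineUnramifiedAt W p Φ ∧ LineOdd W p Φ) ∨ (LineUnramifiedAt W p Φ ∧ LineEven W p Φ))) →
    ¬ Anom W p →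
    W.analyticRank = 1 → Finite W.sha →
    ∃ q : ℚ, W.leadingLCoeff / ((W.realPeriodRat * W.regulator : ℝ) : ℂ) = (q : ℂ) ∧
      padicValRat p q = (padicValNat p W.shaOrder : ℤ) + padicValNat p W.tamagawaProduct

variable {W : WeierstrassCurve ℚ} {p : ℕ} [Fact p.Prime]

/-- **Theorem F ⇒ the general print shape `PPart`** at every pair in its scope, given the per-pair
bit `p ∤ #E(ℚ)_tors` (automatic in print under the theorem's hypotheses — module docstring item 9;
a tree theorem, `Rank1Residual.not_dvd_torsionOrder_of_not_anom`, discharges it in the split file).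
Bookkeeping: with `ord_p #E(ℚ)_tors = 0` the no-torsion display IS `PPart W p`.
[cite: CastellaGrossiLeeSkinner2022, Theorem F = Thm. 5.3.1 (display)] -/
theorem pPart_of_thmF [W.IsElliptic] [W.IsGloballyMinimal] (h : thmF_padicValRat_bsd_rank_one)
    (hp : 2 < p) (hord : GoodOrd W p)
    (hline : ∃ Φ : AddSubgroup (geomTorsion W (p : ℤ)), IsRationalLine W p Φ ∧
      ((¬ LineUnramifiedAt W p Φ ∧ LineOdd W p Φ) ∨ (LineUnramifiedAt W p Φ ∧ LineEven W p Φ)))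
    (hna : ¬ Anom W p) (hr : W.analyticRank = 1) (hfin : Finite W.sha)
    (htors : ¬ p ∣ W.torsionOrder) : PPart W p := by
  obtain ⟨q, hq, hv⟩ := h W p hp hord hline hna hr hfin
  refine ⟨q, hq, ?_⟩
  rw [hv, padicValNat.eq_zero_of_not_dvd htors]
  simp

/-- **Theorem F ⇒ Miller's `BSD(E,p)`** for every `(E,p)` in its scope: `E/ℚ` with
`ord_{s=1} L(E,s) = 1`, `p > 2` a good ordinary Eisenstein prime with `a_p ≢ 1 (mod p)` (`¬ anom(p)`,
= "`φ|_{G_p} ≠ 1, ω`"), a rational `p`-line of parity type (ramified ∧ odd) ∨ (unramified ∧ even), and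
the census bit `p ∤ #E(ℚ)_tors` (automatic in print, item 9). Finiteness of `Ш` is
Gross–Zagier–Kolyvagin (`hGZK` = bsd.S17), modularity `hmod` feeds `L'(E,1) ≠ 0`, and the display
becomes `BSDp W p` through the cell's bridge `Rank1Residual.bsdp_of_pPart`. Beilinson–Flach-free.
[cite: CastellaGrossiLeeSkinner2022, Theorem F = Thm. 5.3.1] [cite: Miller2011LMS, Def. 1.1] -/
theorem bsdp_of_thmF (h : thmF_padicValRat_bsd_rank_one) (hmod : hasEntireLFunction_rat)
    (hGZK : rank_eq_analyticRank_of_analyticRank_le_one)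
    (W : WeierstrassCurve ℚ) [W.IsElliptic] [W.IsGloballyMinimal] (p : ℕ) [Fact p.Prime]
    (hp : 2 < p) (hord : GoodOrd W p)
    (hline : ∃ Φ : AddSubgroup (geomTorsion W (p : ℤ)), IsRationalLine W p Φ ∧
      ((¬ LineUnramifiedAt W p Φ ∧ LineOdd W p Φ) ∨ (LineUnramifiedAt W p Φ ∧ LineEven W p Φ)))
    (hna : ¬ Anom W p) (hr : W.analyticRank = 1) (htors : ¬ p ∣ W.torsionOrder) : BSDp W p :=
  bsdp_of_pPart W p hmod hGZK hr.le
    (pPart_of_thmF h hp hord hline hna hr (hGZK W hr.le).2 htors)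

end Literature.NumberTheory.EllipticCurves.CastellaGrossiLeeSkinner2022
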